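import Summits.Ventures.HSemireg.GeneralStructureWiringBloch
import Summits.HodgeConjecture.HodgeConjecture.Theorems.WeilTypeLadderVariationalLocal
import HarnessLib

/-!
# HSemireg venture · general structure (G4) — the WIRING, cycle form: the CHARTED ∃-over-families statement (what a Bloch-`π` certificate on a
# MODEL of the fibre witnesses) ⟹ `HC_AV`; and why the cycle forms carry NO deformation-free shadow

HONEST FRAMING (speculative tier of cell `pub-hsemireg`, team «general structure», seat G4; verbatim the cell's wording rule):
**nothing here says `HC_AV` or `HC_CM` is proved; every implication carries its named hypotheses.** No `sorry`, no new axiom; axioms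
`propext`, `Classical.choice`, `Quot.sound`. `HC_AV` = `Theses.PadicSemiregularLift.HodgeAbelianVarieties` (stmt-1333); `HC_CM` =
`Theses.RankFourFaces.CMAbelianHodge` (stmt-3052) is ABSENT from the main row (honest column: dominated).

Two points about the CYCLE side of the wiring (Bloch's `π`, the map the cell's engines compute for cycles; transfer = the refereed class-level
fact `BlochSemiregularSpread m p`, Bloch 1972 Thm. (7.4)/(7.5) = Buchweitz–Flenner Thm. 5.2 at `I = {p}`):

* §1 **CHARTED witnesses.** An engine certificate exhibits the cycle `Z` on a MODEL `X₀` of the CM fibre (`X₀ = E^{2n}` in coordinates), not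
  on the scheme-theoretic fibre `𝒳_{s₀}` of the family; transporting an lci and its Bloch-semiregularity along `X₀ ≅ 𝒳_{s₀}` is not a tree
  lemma. Bloch's fact is typed with a chart `e : X₀ ≅ 𝒳_{s₀}` for exactly this reason, so the witness form of the hypothesis should be too:
  `BlochPresentedChartedFamilies` — for every `(A, c)` a smooth projective family through `A` with a fibrewise-Hodge global class `W`
  (`e^*(W|_{𝒳_{s₁}}) = c`), a fibrewise rational-algebraic correction `H`, a point `s₀`, a MODEL `e₀ : X₀ ≅ 𝒳_{s₀}`, and either
  `(W - H)|_{𝒳_{s₀}} = 0` or an integral Bloch-semiregular lci `Z ↪ X₀` of codimension `p` supporting `e₀^*((W - H)|_{𝒳_{s₀}})`. Row BC-1: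
  `(∀ m p, BlochSemiregularSpread m p) ∧ BlochPresentedChartedFamilies ⟹ HC_AV` (Bloch's reduction in kernel form; no `HC_CM`, no Deligne, no
  Catanese). The un-charted companion `BlochPresentedFamilies` (`GeneralStructureWiringBlochFamilies.lean`) is the case `X₀ = 𝒳_{s₀}`,
  `e₀ = Iso.refl`.
* §2 **NO ABSOLUTE SHADOW on the cycle side** (contrast RED-GS GS-9 for the SHEAF forms): whenever the global class `G` is already rational
  and algebraic on EVERY fibre — in particular on the point base `Spec ℂ` (one fibre, on which `G` is algebraic by the antecedent) — the
  conclusion of the cycle ∀-form `UniformBlochLiftAtCM` holds OUTRIGHT with `H := G` (first disjunct): `blochLift_conclusion_of_fibrewise_algebraic`.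
  So the cycle forms assert nothing deformation-free; their whole content is variational (families on which `G` is Hodge but not known
  algebraic away from the CM fibre). This also shows that th-2's `E × E` class (which refutes the `H`-free `CMBlochSeeds`) is absorbed.

## References (bib keys)

Bloch1972Semiregularity (Introduction p. 51; Thm. 7.4, Remark 7.5), BuchweitzFlenner2003 (Thm. 5.2, (8.1), Prop. 8.2), VoisinTorino1994
(Voisin, Lecture 3 «Noether–Lefschetz loci», Thm. 2.3–2.4, pp. 154–155), CharlesSchnell2014Notes (Prop. 11.3.11 (proof)), VoisinHodgeII2003 (§3.1.2), Deligne1982HodgeCycles (§4).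
-/

noncomputable section

open CategoryTheory
open Literature.AlgebraicGeometry Literature.AlgebraicGeometry.Motives
open Literature.AlgebraicGeometry.HodgeTheory

namespace Summit.Ventures.HSemireg.GeneralStructure

open Summit.HodgeConjecture.HodgeConjecture
open Summit.HodgeConjecture.HodgeConjecture.Ring2.Hypotheses (hc_av_iff_hc_cm_and_cmToAbelian)
open Summit.HodgeConjecture.HodgeConjecture.Ring2Transport (HodgeWeilType pathIn hodgeAbelianVarieties_iff_hodgeWeilType)

/-- `QProj[X]` — `X` quasi-projective over `ℂ` (inlined body of `HodgeTheory.IsQuasiProjectiveOver X`). Local notation only. -/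
local notation3 (prettyPrint := false) "QProj[" X "]" =>
  ∃ (P : SchemeOver ℂ) (j : X ⟶ P), IsProjectiveOver P ∧ AlgebraicGeometry.IsOpenImmersion j.left

/-! ### §1 The charted witness form and Bloch's reduction -/

/-- **`BlochPresentedChartedFamilies` — ONE WITNESS FAMILY AND ONE BLOCH-SEMIREGULAR CYCLE ON A MODEL OF ONE FIBRE, PER HODGE CLASS**
(the «general structure» hypothesis, cycle form, ∃ over families, CHARTED; OURS, SPECULATIVE, OPEN — NOT a Literature fact). For every
complex abelian variety `A` and rational `(p,p)` class `c` on `A`: a smooth projective family `f : 𝒳 ⟶ S` of relative dimension `dim A`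
(`𝒳`, `S` quasi-projective, `S` smooth irreducible), a chart `e : A.X ≅ 𝒳_{s₁}`, a global class `W` rational `(p,p)` on EVERY fibre with
`e^*(W|_{𝒳_{s₁}}) = c`, a point `s₀`, a global class `H` rational and algebraic on every fibre, a MODEL `e₀ : X₀ ≅ 𝒳_{s₀}` of the fibre, and
either `(W - H)|_{𝒳_{s₀}} = 0` or an integral local complete intersection `i : Z ↪ X₀` of codimension `p` (points of coheight `≥ p`),
Bloch-semiregular (`IsBlochSemiregular i (dim A) p`), supporting `e₀^*((W - H)|_{𝒳_{s₀}})` — verbatim the hypotheses of the tree fact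
`BlochSemiregularSpread (dim A) p`. CLOSEST PRINT (cycle GIVEN): Bloch 1972 Thm. (7.4) with Remark (7.5). HONEST LABEL (revised
2026-08-22, RED-GS GS-13, kernel: `blochPresentedChartedFamilies_iff_hc_av`, `GeneralStructureWiringConverses.lean`): EQUIVALENT to `HC_AV`
(`H := c` on the constant family); exactly as open as `HC_AV`; useful content per instance only. On-path: `HC_AV → BlochPresentedChartedFamilies`.
NOT asserted. [cite: Bloch1972Semiregularity, Introduction p. 51, Thm. (7.4) and Remark (7.5)] [cite: BuchweitzFlenner2003, Thm. 5.2, (8.1) and Prop. 8.2]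
[cite: VoisinTorino1994, Lecture 3 (Noether–Lefschetz loci), Thm. 2.3–2.4, pp. 154–155] [status: open] -/
@[conjecture] def BlochPresentedChartedFamilies : Prop :=
  ∀ (A : AbelianVariety ℂ) (p : ℕ) (c : HodgeTheory.complexBetti A.X (2 * p)),
    HodgeTheory.IsRationalClass c → HodgeTheory.IsOfHodgeType A.dim A.X (2 * p) p p c →
    ∃ (𝒳 S : SchemeOver ℂ) (f : 𝒳 ⟶ S) (s₁ : ComplexPoints S) (e : A.X ≅ fiberOver f s₁)
      (W : HodgeTheory.complexBetti 𝒳 (2 * p)),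
      IsSmoothProjectiveFamily f A.dim ∧ QProj[𝒳] ∧ QProj[S] ∧ IrreducibleSpace S.left ∧ AlgebraicGeometry.Smooth S.hom ∧
      (∀ s : ComplexPoints S, HodgeTheory.IsRationalClass (HodgeTheory.complexBetti.map (fiberι f s) (2 * p) W) ∧
        HodgeTheory.IsOfHodgeType A.dim (fiberOver f s) (2 * p) p p (HodgeTheory.complexBetti.map (fiberι f s) (2 * p) W)) ∧
      HodgeTheory.complexBetti.map e.hom (2 * p) (HodgeTheory.complexBetti.map (fiberι f s₁) (2 * p) W) = c ∧
      ∃ (s₀ : ComplexPoints S) (H : HodgeTheory.complexBetti 𝒳 (2 * p)) (X₀ : SchemeOver ℂ) (e₀ : X₀ ≅ fiberOver f s₀),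
        (∀ t : ComplexPoints S, IsRationalClass (complexBetti.map (fiberι f t) (2 * p) H) ∧
          complexBetti.map (fiberι f t) (2 * p) H ∈ algebraicClasses (fiberOver f t) p) ∧
        (complexBetti.map (fiberι f s₀) (2 * p) (W - H) = 0 ∨
          ∃ (Z : AlgebraicGeometry.Scheme.{0}) (i : Z ⟶ X₀.left),
            AlgebraicGeometry.IsClosedImmersion i ∧ IsRegularImmersionOfCodim i p ∧
            AlgebraicGeometry.IsIntegral Z ∧ (∀ z ∈ Set.range i.base, (p : ℕ∞) ≤ Order.coheight z) ∧
            IsBlochSemiregular i A.dim p ∧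
            complexBetti.map e₀.hom (2 * p) (complexBetti.map (fiberι f s₀) (2 * p) (W - H)) ∈
              classesSupportedOn X₀ (Set.range i.base) (2 * p))

/-- **BC-1 — `(∀ m p, BlochSemiregularSpread m p) ∧ BlochPresentedChartedFamilies ⟹ HC_AV`** (kernel-checked; literature input = Bloch 1972
Thm. 7.4 / BF Thm. 5.2, refereed named fact; NO `HC_CM`, NO Deligne, NO CM point, NO Catanese). As the un-charted row, with Bloch's fact applied
on the model `X₀` through the chart `e₀`. GRADE (RED-GS GS-13, revised 2026-08-22): in-tree reduction step (kernel-checked); as a ROW a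
restatement — the hypothesis `↔ HC_AV` (`blochPresentedChartedFamilies_iff_hc_av`); Bloch 1972 p. 51 = the variational reduction, whose content is per instance.
[cite: Bloch1972Semiregularity, Thm. (7.4) and Remark (7.5)] [cite: BuchweitzFlenner2003, Thm. 5.2] [cite: CharlesSchnell2014Notes, Prop. 11.3.11 (proof)]
[cite: VoisinHodgeII2003, §3.1.2] -/
theorem hc_av_of_blochSpread_of_blochPresentedChartedFamilies (hB : ∀ m p : ℕ, BlochSemiregularSpread m p)
    (hF : BlochPresentedChartedFamilies) : Theses.PadicSemiregularLift.HodgeAbelianVarieties := by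
  intro A
  refine ⟨nonempty_hodgeModel_holds AbelianVariety.isSmoothProjective_holds, fun p c hc hh ↦ ?_⟩
  obtain ⟨𝒳, S, f, s₁, e, W, hf, h𝒳, hS, hirr, hsm, hW, hWc, s₀, H, X₀, e₀, hH, hcase⟩ := hF A p c hc hh
  have hq𝒳 : IsQuasiProjectiveOver 𝒳 := h𝒳
  have hqS : IsQuasiProjectiveOver S := hS
  have hWfib : ∀ s : ComplexPoints S,
      IsRationalClass (complexBetti.map (fiberι f s) (2 * p) (W - H)) ∧
        IsOfHodgeType A.dim (fiberOver f s) (2 * p) p p (complexBetti.map (fiberι f s) (2 * p) (W - H)) := by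
    intro s
    have hX : IsSmoothProjective A.dim (fiberOver f s) := hf.isSmoothProjective s
    rw [map_sub]
    refine ⟨?_, (hW s).2.sub hX (isOfHodgeType_of_mem_algebraicClasses_of_isSmoothProjective hX p (hH s).2)⟩
    have hr := (hW s).1.add ((hH s).1.smul (-1 : ℚ))
    rwa [Rat.cast_neg, Rat.cast_one, neg_one_smul, ← sub_eq_add_neg] at hr
  have hsplit : ∀ t : ComplexPoints S, complexBetti.map (fiberι f t) (2 * p) W =
      complexBetti.map (fiberι f t) (2 * p) (W - H) + complexBetti.map (fiberι f t) (2 * p) H := by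
    intro t
    rw [map_sub, sub_add_cancel]
  have hgerm : ∃ U : Set (ComplexPoints S), IsOpen U ∧ s₀ ∈ U ∧ ∀ t ∈ U,
      complexBetti.map (fiberι f t) (2 * p) (W - H) ∈ algebraicClasses (fiberOver f t) p := by
    rcases hcase with h0 | ⟨Z, i, hci, hreg, hint, hcoh, hsr, hsupp⟩
    · have hU : IsCohomologicallyLocallyTrivialOn f (Set.univ : Set (ComplexPoints S)) :=
        isCohomologicallyLocallyTrivialOn_univ_of_isQuasiProjectiveOver f hf hqS hsm
      haveI := hsm
      haveI : LocallyPathConnectedSpace (ComplexPoints S) := locallyPathConnectedSpace_complexPoints_of_smooth S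
      refine ⟨pathComponentIn Set.univ s₀, isOpen_univ.pathComponentIn s₀,
        mem_pathComponentIn_self (Set.mem_univ _), fun t ht ↦ ?_⟩
      have hJ : JoinedIn Set.univ s₀ t := ht
      set γ₀ : Path s₀ t := hJ.somePath
      have hγ : ∀ ρ, γ₀ ρ ∈ (Set.univ : Set (ComplexPoints S)) := fun _ ↦ Set.mem_univ _
      have hGt : complexBetti.map (fiberι f t) (2 * p) (W - H) =
          transportFun f (2 * p) hU ⟦pathIn γ₀ Set.univ hγ⟧ (complexBetti.map (fiberι f s₀) (2 * p) (W - H)) :=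
        (transportFun_map_fiberι f (2 * p) hU ⟦pathIn γ₀ Set.univ hγ⟧ (W - H)).symm
      rw [hGt, h0, ← transportLinear_apply, map_zero]
      exact Submodule.zero_mem _
    · obtain ⟨U, hUo, hs₀U, hU⟩ := hB A.dim p X₀ Z i
        (complexBetti.map e₀.hom (2 * p) (complexBetti.map (fiberι f s₀) (2 * p) (W - H))) 𝒳 S f s₀ e₀ (W - H)
        hci hreg hint hcoh hsr hsupp hf hq𝒳 hqS hsm hWfib rfl
      exact ⟨U, hUo, hs₀U, hU⟩
  obtain ⟨U, hUo, hs₀U, hUalg⟩ := hgerm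
  haveI := hirr
  have hall := WeilTypeLadder.mem_algebraicClasses_of_isOpen_subset_algebraicityLocus f hq𝒳 hqS hsm hf W hUo ⟨s₀, hs₀U⟩
    (fun t ht ↦ by rw [hsplit t]; exact Submodule.add_mem _ (hUalg t ht) (hH t).2)
  rw [← hWc]
  exact (mem_algebraicClasses_map_iff_of_iso e).2 (hall s₁)

/-- **BC-2 — `↔ HodgeWeilType`** (ring 2's exactness). [cite: Deligne1982HodgeCycles, §4 Lemma 4.5 and Remark 4.10] [cite: Bloch1972Semiregularity, Thm. (7.4)] -/
theorem hodgeWeilType_of_blochSpread_of_blochPresentedChartedFamilies (hB : ∀ m p : ℕ, BlochSemiregularSpread m p)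
    (hF : BlochPresentedChartedFamilies) : HodgeWeilType :=
  hodgeAbelianVarieties_iff_hodgeWeilType.1 (hc_av_of_blochSpread_of_blochPresentedChartedFamilies hB hF)

/-- **HONEST COLUMN: `HC_CM` is DOMINATED on this row.** [cite: Bloch1972Semiregularity, Introduction p. 51] -/
theorem hc_cm_of_blochSpread_of_blochPresentedChartedFamilies (hB : ∀ m p : ℕ, BlochSemiregularSpread m p)
    (hF : BlochPresentedChartedFamilies) : Theses.RankFourFaces.CMAbelianHodge :=
  Ring2.Deform.HC_CM_of_HC_AV (hc_av_of_blochSpread_of_blochPresentedChartedFamilies hB hF)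

/-! ### §2 The cycle forms have no deformation-free shadow -/

/-- **NO ABSOLUTE SHADOW (cycle side).** If the global class `G` is rational and ALGEBRAIC ON EVERY fibre of the family, the conclusion of
the cycle ∀-form `UniformBlochLiftAtCM` at that family holds outright: take `H := G` (first disjunct, `(G - G)|_{A₀} = 0`). In particular
on the point base `Spec ℂ` (one fibre, on which `G` is algebraic by the antecedent) the cycle forms assert NOTHING — contrast the sheaf
forms, whose point-base instance is the deformation-free statement (★) (`existsAnchor_pointBase`, `GeneralStructureWiringFamilies.lean`);
and th-2's `E × E` class `[E×0] - [0×E]` (which refutes the `H`-free `CMBlochSeeds`) is absorbed. The statement is the literal ∃-conclusion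
of `UniformBlochLiftAtCM` for arbitrary binders. [cite: Bloch1972Semiregularity, Remark (7.5)] -/
theorem blochLift_conclusion_of_fibrewise_algebraic {𝒳 S : SchemeOver ℂ} (f : 𝒳 ⟶ S) (m p : ℕ)
    (G : HodgeTheory.complexBetti 𝒳 (2 * p)) (A₀ : AbelianVariety ℂ) (e₀ : A₀.X ⟶ 𝒳)
    (hG : ∀ t : ComplexPoints S, IsRationalClass (complexBetti.map (fiberι f t) (2 * p) G) ∧
      complexBetti.map (fiberι f t) (2 * p) G ∈ algebraicClasses (fiberOver f t) p) :
    ∃ H : HodgeTheory.complexBetti 𝒳 (2 * p),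
      (∀ t : ComplexPoints S, IsRationalClass (complexBetti.map (fiberι f t) (2 * p) H) ∧
        complexBetti.map (fiberι f t) (2 * p) H ∈ algebraicClasses (fiberOver f t) p) ∧
      (complexBetti.map e₀ (2 * p) (G - H) = 0 ∨
        ∃ (Z : AlgebraicGeometry.Scheme.{0}) (i : Z ⟶ A₀.X.left),
          AlgebraicGeometry.IsClosedImmersion i ∧ IsRegularImmersionOfCodim i p ∧
          AlgebraicGeometry.IsIntegral Z ∧ (∀ z ∈ Set.range i.base, (p : ℕ∞) ≤ Order.coheight z) ∧
          IsBlochSemiregular i m p ∧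
          complexBetti.map e₀ (2 * p) (G - H) ∈ classesSupportedOn A₀.X (Set.range i.base) (2 * p)) :=
  ⟨G, hG, Or.inl (by rw [sub_self, map_zero])⟩

/-- **BC-3 — POSITION** (conjunction of tree theorems): Bloch 7.4 ∧ the charted cycle-presented families ⟹ `HC_AV`;
`HC_AV ↔ HC_CM ∧ CMToAbelian`; `HC_AV ↔ HodgeWeilType`. [cite: Bloch1972Semiregularity, Thm. (7.4)] [cite: Deligne1982HodgeCycles, §4] -/
theorem blochCharted_position :
    ((∀ m p : ℕ, BlochSemiregularSpread m p) → BlochPresentedChartedFamilies → Theses.PadicSemiregularLift.HodgeAbelianVarieties) ∧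
    (Theses.PadicSemiregularLift.HodgeAbelianVarieties ↔
      Theses.RankFourFaces.CMAbelianHodge ∧ Theses.RankFourFaces.CMToAbelian) ∧
    (Theses.PadicSemiregularLift.HodgeAbelianVarieties ↔ HodgeWeilType) :=
  ⟨hc_av_of_blochSpread_of_blochPresentedChartedFamilies, hc_av_iff_hc_cm_and_cmToAbelian, hodgeAbelianVarieties_iff_hodgeWeilType⟩

/-! ## Audit: nothing is decided here

Every theorem above whose conclusion is `HC_AV`, `HodgeWeilType` or `HC_CM` has among its hypotheses the team's OPEN, SPECULATIVE
`BlochPresentedChartedFamilies` and the refereed named fact `BlochSemiregularSpread` (all `m, p`); §2 is a tautology about the shape of the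
cycle ∀-form's conclusion; the position row is a conjunction of tree theorems. Axiom closures: the three standard axioms only. -/

#print axioms Summit.Ventures.HSemireg.GeneralStructure.hc_av_of_blochSpread_of_blochPresentedChartedFamilies
#print axioms Summit.Ventures.HSemireg.GeneralStructure.blochLift_conclusion_of_fibrewise_algebraic

end Summit.Ventures.HSemireg.GeneralStructure

end
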